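import Summits.ValiantsHypothesis.ValiantsHypothesis.Theorems.GrenetZeonDualUnipotentThreeHalvesHeavyTopInitialLift
import Summits.ValiantsHypothesis.ValiantsHypothesis.Theorems.GrenetZeonDualUnipotentThreeHalvesHeavyTopBorderEnvelope

/-!
# `GrenetZeon.DualUnipotentThreeHalves` (stmt-ValiantsHypothesis-24318), R2 heavy-top instrument — P-Q1 Level 2, L2.7a THE CHART:
# the full envelope `T′`, the graded complement `C` of `W⁽ᶜ⁾` in `T′`, and unique lifts (Q1-PROOF §2 CHART, via ✓ `HeavyTopInitialLift`)

Experiment cell «val-heavytop-census» (D-0160), engine seat val-htc-eng-2 g3 (kernel-only lane; P-Q1 port, eng lineage; lead Level-2 port map L2.0/L2.7).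
Data (0-based, `Fin (s+1)`, `ω = Fin.last s`, `A = J_s ⊕ 0`): a space `V` with `Z^s = 0` on `V`, `A ∈ V`; its border-graded limit `W` in the explicit form
`W = W⁽ᶜ⁾` delivered by ✓ `HeavyTopLevelOneSubspace.level_one_of_subspace` (here taken as hypotheses: `finrank W = finrank V`, the initial-form
clause, and the shape `Z ∈ W ↔ …`).  THIS FILE builds the chart of Q1-PROOF §2:

* `T′ := {B : σ_h(B) = 0 (h < s), B_{ω0} = 0, B_{s−1,ω} = 0, B_{ωω} = 0}` (✓ `HeavyTopBorderEnvelope.envelope_of_mem` + `tr = 0`), `V ≤ T′`, `W ≤ T′`;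
* `C := {X ∈ T′ : block part lower triangular (with diagonal), column-ω part in rows ≥ c, row-ω part in columns ≤ c}` — a GRADED complement of
  `W⁽ᶜ⁾` in `T′` (`W ⊓ C = ⊥`, `T′ ≤ W ⊔ C`);
* ★ `chart` — packages `T′`, `C` (by their membership conditions) with `V ⊓ C = ⊥`, `T′ ≤ V ⊔ C` and the UNIQUE-LIFT clause of
  ✓ `HeavyTopInitialLift.lift_exists_unique` (every homogeneous `b ∈ W` of degree `d` has a unique `v ∈ V`, `v − b ∈ C`, tail without components of
  degree `≤ d`).  The lift SHAPES (`ŵ_j = E_{ωj} + τ_j + γ_j`, `Ê = E_{01} + γ`, …) are read off in the companion `…HeavyTopLevelTwoLifts`.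

Honest framing: a step of the instrument's kernel port P-Q1 (Level 2); nothing here proves or refutes `HeavyTopLaw`/`HeavyTopSlowLaw`, 24318, S3 or 8062;
`VP ≠ VNP` is NOT proved.  No definitions.  [Q1-PROOF §2 (val-htc-lead g2); this seat]
-/

noncomputable section

-- single-conjunct layout: Sub = Summit, duplicated namespace component intended
set_option linter.dupNamespace false

namespace Summit.ValiantsHypothesis.ValiantsHypothesis.Theorems.GrenetZeon.HeavyTopLevelTwoChart

open Matrix
open Summit.ValiantsHypothesis.ValiantsHypothesis.Theorems.GrenetZeon.HeavyTopInitialLift (lift_exists_unique)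
open Summit.ValiantsHypothesis.ValiantsHypothesis.Theorems.GrenetZeon.HeavyTopBorderEnvelope (envelope_of_mem)

/-- ★ **The chart (L2.7a).**  See the module docstring.  Degrees are written with the border weights `ρ x = if x = ω then 0 else 1`
(so `deg (a,b) = ρ a − ρ b`: column `ω` = `+1`, row `ω` = `−1`, block and corner = `0`), exactly as in ✓ `HeavyTopTorusInitial` /
✓ `HeavyTopLevelOneSubspace`. [Q1-PROOF §2 CHART] -/
theorem chart {s : ℕ} (hs : 3 ≤ s) (A : Matrix (Fin (s + 1)) (Fin (s + 1)) ℂ)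
    (hA : ∀ i j : Fin (s + 1), A i j = if (j : ℕ) = i + 1 ∧ (j : ℕ) < s then 1 else 0)
    (V W : Submodule ℂ (Matrix (Fin (s + 1)) (Fin (s + 1)) ℂ)) (hV : ∀ Z ∈ V, Z ^ s = 0) (hAV : A ∈ V)
    (hfin : Module.finrank ℂ W = Module.finrank ℂ V)
    (hWinit : ∀ Z ∈ V, ∀ d : ℤ, (∀ a b : Fin (s + 1),
        ((fun x : Fin (s + 1) => if x = Fin.last s then (0 : ℕ) else 1) a : ℤ) -
          (fun x : Fin (s + 1) => if x = Fin.last s then (0 : ℕ) else 1) b < d → Z a b = 0) →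
      (Matrix.of fun a b : Fin (s + 1) =>
        if ((fun x : Fin (s + 1) => if x = Fin.last s then (0 : ℕ) else 1) a : ℤ) -
            (fun x : Fin (s + 1) => if x = Fin.last s then (0 : ℕ) else 1) b = d then Z a b else 0) ∈ W)
    (c : ℕ) (hc : c ≤ s - 1)
    (hshape : ∀ Z : Matrix (Fin (s + 1)) (Fin (s + 1)) ℂ, Z ∈ W ↔ ∀ a b : Fin (s + 1), Z a b ≠ 0 →
      (a.val < b.val ∧ b ≠ Fin.last s) ∨ (b = Fin.last s ∧ a.val < c) ∨ (a = Fin.last s ∧ c < b.val ∧ b ≠ Fin.last s)) :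
    ∃ T' C : Submodule ℂ (Matrix (Fin (s + 1)) (Fin (s + 1)) ℂ),
      (∀ B, B ∈ T' ↔ (B (Fin.last s) 0 = 0 ∧ B ⟨s - 1, by omega⟩ (Fin.last s) = 0 ∧ B (Fin.last s) (Fin.last s) = 0 ∧
        ∀ h : ℕ, h < s → ∑ x : Fin s, (if h ≤ x.val then B (Fin.castSucc x) ⟨x.val - h, by omega⟩ else 0) = 0)) ∧
      (∀ X, X ∈ C ↔ (X ∈ T' ∧ (∀ a b : Fin (s + 1), a ≠ Fin.last s → b ≠ Fin.last s → a.val < b.val → X a b = 0) ∧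
        (∀ a : Fin (s + 1), a ≠ Fin.last s → a.val < c → X a (Fin.last s) = 0) ∧
        (∀ b : Fin (s + 1), b ≠ Fin.last s → c < b.val → X (Fin.last s) b = 0))) ∧
      V ≤ T' ∧ W ≤ T' ∧ V ⊓ C = ⊥ ∧ T' ≤ V ⊔ C ∧
      ∀ b ∈ W, ∀ d : ℤ, (Matrix.of fun a' b' : Fin (s + 1) =>
          if ((fun x : Fin (s + 1) => if x = Fin.last s then (0 : ℕ) else 1) a' : ℤ) -
              (fun x : Fin (s + 1) => if x = Fin.last s then (0 : ℕ) else 1) b' = d then b a' b' else 0) = b →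
        ∃ v ∈ V, v - b ∈ C ∧
          (∀ e : ℤ, e ≤ d → (Matrix.of fun a' b' : Fin (s + 1) =>
            if ((fun x : Fin (s + 1) => if x = Fin.last s then (0 : ℕ) else 1) a' : ℤ) -
                (fun x : Fin (s + 1) => if x = Fin.last s then (0 : ℕ) else 1) b' = e then (v - b) a' b' else 0) = 0) ∧
          ∀ v' ∈ V, v' - b ∈ C → v' = v := by
  classical
  have hs1 : 1 ≤ s := by omega
  set ω : Fin (s + 1) := Fin.last s with hωdef
  have hωv : ω.val = s := by simp [hωdef]
  set ρ : Fin (s + 1) → ℕ := fun x => if x = ω then 0 else 1 with hρ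
  have hdeg : ∀ a b : Fin (s + 1), ((ρ a : ℤ) - ρ b = 1 ↔ (a ≠ ω ∧ b = ω)) ∧ ((ρ a : ℤ) - ρ b = -1 ↔ (a = ω ∧ b ≠ ω)) ∧
      ((ρ a : ℤ) - ρ b = 0 ↔ (a = ω ↔ b = ω)) := by
    intro a b
    by_cases ha : a = ω <;> by_cases hb : b = ω <;> simp [hρ, ha, hb]
  -- the full envelope `T'`
  let P : Matrix (Fin (s + 1)) (Fin (s + 1)) ℂ → Prop := fun B => B ω 0 = 0 ∧ B ⟨s - 1, by omega⟩ ω = 0 ∧ B ω ω = 0 ∧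
    ∀ h : ℕ, h < s → ∑ x : Fin s, (if h ≤ x.val then B (Fin.castSucc x) ⟨x.val - h, by omega⟩ else 0) = 0
  have hPiff : ∀ B, P B ↔ (B ω 0 = 0 ∧ B ⟨s - 1, by omega⟩ ω = 0 ∧ B ω ω = 0 ∧
      ∀ h : ℕ, h < s → ∑ x : Fin s, (if h ≤ x.val then B (Fin.castSucc x) ⟨x.val - h, by omega⟩ else 0) = 0) := fun B => Iff.rfl
  have hσadd : ∀ (B B' : Matrix (Fin (s + 1)) (Fin (s + 1)) ℂ) (h : ℕ),
      (∑ x : Fin s, (if h ≤ x.val then (B + B') (Fin.castSucc x) ⟨x.val - h, by omega⟩ else 0)) =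
        (∑ x : Fin s, (if h ≤ x.val then B (Fin.castSucc x) ⟨x.val - h, by omega⟩ else 0)) +
          ∑ x : Fin s, (if h ≤ x.val then B' (Fin.castSucc x) ⟨x.val - h, by omega⟩ else 0) := by
    intro B B' h
    rw [← Finset.sum_add_distrib]
    refine Finset.sum_congr rfl fun x _ => ?_
    split_ifs <;> simp
  have hσsmul : ∀ (cc : ℂ) (B : Matrix (Fin (s + 1)) (Fin (s + 1)) ℂ) (h : ℕ),
      (∑ x : Fin s, (if h ≤ x.val then (cc • B) (Fin.castSucc x) ⟨x.val - h, by omega⟩ else 0)) =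
        cc * ∑ x : Fin s, (if h ≤ x.val then B (Fin.castSucc x) ⟨x.val - h, by omega⟩ else 0) := by
    intro cc B h
    rw [Finset.mul_sum]
    refine Finset.sum_congr rfl fun x _ => ?_
    split_ifs <;> simp
  obtain ⟨T', hT'⟩ : ∃ T' : Submodule ℂ (Matrix (Fin (s + 1)) (Fin (s + 1)) ℂ), ∀ B, B ∈ T' ↔ P B :=
    ⟨{ carrier := {B | P B}
       zero_mem' := ⟨rfl, rfl, rfl, fun h _ => Finset.sum_eq_zero fun x _ => by simp⟩
       add_mem' := fun {B B'} hB hB' => ⟨by simp [hB.1, hB'.1], by simp [hB.2.1, hB'.2.1], by simp [hB.2.2.1, hB'.2.2.1],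
         fun h hh => by rw [hσadd, hB.2.2.2 h hh, hB'.2.2.2 h hh, add_zero]⟩
       smul_mem' := fun cc B hB => ⟨by simp [hB.1], by simp [hB.2.1], by simp [hB.2.2.1],
         fun h hh => by rw [hσsmul, hB.2.2.2 h hh, mul_zero]⟩ }, fun B => Iff.rfl⟩
  -- `T'` is graded
  have hσproj : ∀ (B : Matrix (Fin (s + 1)) (Fin (s + 1)) ℂ) (d : ℤ) (h : ℕ), h < s →
      (∑ x : Fin s, (if h ≤ x.val then (Matrix.of fun a b : Fin (s + 1) => if (ρ a : ℤ) - ρ b = d then B a b else 0)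
          (Fin.castSucc x) ⟨x.val - h, by omega⟩ else 0)) =
        if d = 0 then ∑ x : Fin s, (if h ≤ x.val then B (Fin.castSucc x) ⟨x.val - h, by omega⟩ else 0) else 0 := by
    intro B d h hh
    have hdeg0 : ∀ x : Fin s, h ≤ x.val → ((ρ (Fin.castSucc x) : ℤ) - ρ ⟨x.val - h, by omega⟩ = 0) := by
      intro x hx
      rw [(hdeg _ _).2.2]
      constructor
      · intro e; exact absurd e (Fin.castSucc_ne_last x)
      · intro e; rw [Fin.ext_iff, hωv] at e; simp at e; omega
    by_cases hd : d = 0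
    · subst hd; rw [if_pos rfl]
      refine Finset.sum_congr rfl fun x _ => ?_
      by_cases hx : h ≤ x.val
      · rw [if_pos hx, if_pos hx, Matrix.of_apply, if_pos (hdeg0 x hx)]
      · rw [if_neg hx, if_neg hx]
    · rw [if_neg hd]
      refine Finset.sum_eq_zero fun x _ => ?_
      by_cases hx : h ≤ x.val
      · rw [if_pos hx, Matrix.of_apply, if_neg (by rw [hdeg0 x hx]; exact fun e => hd e.symm)]
      · rw [if_neg hx]
  have hT'gr : ∀ B ∈ T', ∀ d : ℤ, (Matrix.of fun a b : Fin (s + 1) => if (ρ a : ℤ) - ρ b = d then B a b else 0) ∈ T' := by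
    intro B hB d
    obtain ⟨h0, h1, h2, hσ⟩ := (hT' B).1 hB
    refine (hT' _).2 ⟨?_, ?_, ?_, fun h hh => ?_⟩
    · simp only [Matrix.of_apply]; split_ifs <;> simp [h0]
    · simp only [Matrix.of_apply]; split_ifs <;> simp [h1]
    · simp only [Matrix.of_apply]; split_ifs <;> simp [h2]
    · rw [hσproj B d h hh]; split_ifs
      · exact hσ h hh
      · rfl
  -- `V ≤ T'`
  have hVT' : V ≤ T' := by
    intro Z hZ
    obtain ⟨h0, h1, hσ⟩ := envelope_of_mem hs1 V hV A hA hAV Z hZ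
    refine (hT' Z).2 ⟨h0, h1, ?_, hσ⟩
    have hσ0 := hσ 0 (by omega)
    have htr : Matrix.trace Z = 0 := (Matrix.isNilpotent_trace_of_isNilpotent ⟨s, hV Z hZ⟩).eq_zero
    rw [Matrix.trace, Fin.sum_univ_castSucc] at htr
    have e : ∀ x : Fin s, (if 0 ≤ x.val then Z (Fin.castSucc x) ⟨x.val - 0, by omega⟩ else 0) = Z (Fin.castSucc x) (Fin.castSucc x) := by
      intro x; rw [if_pos (Nat.zero_le _)]; congr 1
    simp only [e, Matrix.diag_apply] at hσ0 htr
    rw [hσ0, zero_add] at htr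
    exact htr
  -- `W ≤ T'` from the shape
  have hWT' : W ≤ T' := by
    intro Z hZ
    have hz := (hshape Z).1 hZ
    have zero_of : ∀ a b : Fin (s + 1), ¬ ((a.val < b.val ∧ b ≠ ω) ∨ (b = ω ∧ a.val < c) ∨ (a = ω ∧ c < b.val ∧ b ≠ ω)) → Z a b = 0 :=
      fun a b h => by by_contra hne; exact h (hz a b hne)
    refine (hT' Z).2 ⟨zero_of _ _ (by simp [hωv]; omega), zero_of _ _ ?_, zero_of _ _ (by simp [hωv]; omega), fun h hh => ?_⟩
    · simp only [hωv]; push Not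
      refine ⟨fun _ => rfl, fun _ => by omega, fun h' => ?_⟩
      rw [Fin.ext_iff, hωv] at h'; simp at h'; omega
    · refine Finset.sum_eq_zero fun x _ => ?_
      by_cases hx : h ≤ x.val
      · rw [if_pos hx]
        apply zero_of
        push Not
        refine ⟨fun hlt => absurd hlt (by simp), fun h' => absurd h' ?_, fun h' => absurd h' (Fin.castSucc_ne_last x)⟩
        intro e; rw [Fin.ext_iff, hωv] at e; simp at e; omega
      · rw [if_neg hx]
  -- the complement `C`
  let Q : Matrix (Fin (s + 1)) (Fin (s + 1)) ℂ → Prop := fun X => X ∈ T' ∧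
    (∀ a b : Fin (s + 1), a ≠ ω → b ≠ ω → a.val < b.val → X a b = 0) ∧
    (∀ a : Fin (s + 1), a ≠ ω → a.val < c → X a ω = 0) ∧ (∀ b : Fin (s + 1), b ≠ ω → c < b.val → X ω b = 0)
  obtain ⟨C, hC⟩ : ∃ C : Submodule ℂ (Matrix (Fin (s + 1)) (Fin (s + 1)) ℂ), ∀ X, X ∈ C ↔ Q X :=
    ⟨{ carrier := {X | Q X}
       zero_mem' := ⟨T'.zero_mem, fun _ _ _ _ _ => rfl, fun _ _ _ => rfl, fun _ _ _ => rfl⟩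
       add_mem' := fun {X Y} hX hY => ⟨T'.add_mem hX.1 hY.1,
         fun a b ha hb hab => by rw [Matrix.add_apply, hX.2.1 a b ha hb hab, hY.2.1 a b ha hb hab, add_zero],
         fun a ha hac => by rw [Matrix.add_apply, hX.2.2.1 a ha hac, hY.2.2.1 a ha hac, add_zero],
         fun b hb hcb => by rw [Matrix.add_apply, hX.2.2.2 b hb hcb, hY.2.2.2 b hb hcb, add_zero]⟩
       smul_mem' := fun cc X hX => ⟨T'.smul_mem cc hX.1,
         fun a b ha hb hab => by rw [Matrix.smul_apply, hX.2.1 a b ha hb hab, smul_zero],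
         fun a ha hac => by rw [Matrix.smul_apply, hX.2.2.1 a ha hac, smul_zero],
         fun b hb hcb => by rw [Matrix.smul_apply, hX.2.2.2 b hb hcb, smul_zero]⟩ }, fun X => Iff.rfl⟩
  have hCT' : C ≤ T' := fun X hX => ((hC X).1 hX).1
  have hCgr : ∀ X ∈ C, ∀ d : ℤ, (Matrix.of fun a b : Fin (s + 1) => if (ρ a : ℤ) - ρ b = d then X a b else 0) ∈ C := by
    intro X hX d
    obtain ⟨hXT, hXb, hXc, hXr⟩ := (hC X).1 hX
    refine (hC _).2 ⟨hT'gr X hXT d, fun a b ha hb hab => ?_, fun a ha hac => ?_, fun b hb hcb => ?_⟩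
    · simp only [Matrix.of_apply]; split_ifs <;> simp [hXb a b ha hb hab]
    · simp only [Matrix.of_apply]; split_ifs <;> simp [hXc a ha hac]
    · simp only [Matrix.of_apply]; split_ifs <;> simp [hXr b hb hcb]
  have hWC : W ⊓ C = ⊥ := by
    rw [eq_bot_iff]
    rintro X ⟨hXW, hXC⟩
    rw [Submodule.mem_bot]
    have hz := (hshape X).1 hXW
    obtain ⟨hXT, hXb, hXc, hXr⟩ := (hC X).1 hXC
    ext a b
    rw [Matrix.zero_apply]
    by_contra hne
    rcases hz a b hne with ⟨h1, h2⟩ | ⟨h1, h2⟩ | ⟨h1, h2, h3⟩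
    · have ha : a ≠ ω := fun e => by rw [e, hωv] at h1; have := b.isLt; omega
      exact hne (hXb a b ha h2 h1)
    · have ha : a ≠ ω := fun e => by rw [e, hωv] at h2; omega
      rw [h1] at hne; exact hne (hXc a ha h2)
    · rw [h1] at hne; exact hne (hXr b h3 h2)
  have hT'WC : T' ≤ W ⊔ C := by
    intro X hX
    obtain ⟨h0, h1, h2, hσ⟩ := (hT' X).1 hX
    -- the `W`-part of `X`
    set Xw : Matrix (Fin (s + 1)) (Fin (s + 1)) ℂ := Matrix.of fun a b : Fin (s + 1) =>
      if (a.val < b.val ∧ b ≠ ω) ∨ (b = ω ∧ a.val < c) ∨ (a = ω ∧ c < b.val ∧ b ≠ ω) then X a b else 0 with hXw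
    have hXwW : Xw ∈ W := (hshape Xw).2 (fun a b hab => by
      by_contra hno; exact hab (by rw [hXw, Matrix.of_apply, if_neg hno]))
    have hXcC : X - Xw ∈ C := by
      refine (hC _).2 ⟨(hT' _).2 ⟨?_, ?_, ?_, fun h hh => ?_⟩, fun a b ha hb hab => ?_, fun a ha hac => ?_, fun b hb hcb => ?_⟩
      · rw [Matrix.sub_apply, h0, hXw, Matrix.of_apply, if_neg (by simp [hωv]; omega)]; simp
      · rw [Matrix.sub_apply, h1, hXw, Matrix.of_apply, if_neg]; · simp
        simp only [hωv]; push Not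
        refine ⟨fun _ => rfl, fun _ => by omega, fun h' => ?_⟩
        rw [Fin.ext_iff, hωv] at h'; simp at h'; omega
      · rw [Matrix.sub_apply, h2, hXw, Matrix.of_apply, if_neg (by simp [hωv]; omega)]; simp
      · have e : ∀ x : Fin s, (if h ≤ x.val then (X - Xw) (Fin.castSucc x) ⟨x.val - h, by omega⟩ else 0) =
            (if h ≤ x.val then X (Fin.castSucc x) ⟨x.val - h, by omega⟩ else 0) := by
          intro x
          by_cases hx : h ≤ x.val
          · rw [if_pos hx, if_pos hx, Matrix.sub_apply, hXw, Matrix.of_apply, if_neg, sub_zero]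
            push Not
            refine ⟨fun hlt => absurd hlt (by simp), fun h' => absurd h' ?_, fun h' => absurd h' (Fin.castSucc_ne_last x)⟩
            intro e; rw [Fin.ext_iff, hωv] at e; simp at e; omega
          · rw [if_neg hx, if_neg hx]
        simp only [e]; exact hσ h hh
      · rw [Matrix.sub_apply, hXw, Matrix.of_apply, if_pos (Or.inl ⟨hab, hb⟩), sub_self]
      · rw [Matrix.sub_apply, hXw, Matrix.of_apply, if_pos (Or.inr (Or.inl ⟨rfl, hac⟩)), sub_self]
      · rw [Matrix.sub_apply, hXw, Matrix.of_apply, if_pos (Or.inr (Or.inr ⟨rfl, hcb, hb⟩)), sub_self]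
    have e : X = Xw + (X - Xw) := by abel
    rw [e]
    exact Submodule.add_mem _ (Submodule.mem_sup_left hXwW) (Submodule.mem_sup_right hXcC)
  obtain ⟨hVC, hT'VC, hlift⟩ := lift_exists_unique ρ V T' W C hfin hWinit hVT' hWT' hCT' hCgr hWC hT'WC
  exact ⟨T', C, fun B => hT' B, fun X => hC X, hVT', hWT', hVC, hT'VC, hlift⟩

end Summit.ValiantsHypothesis.ValiantsHypothesis.Theorems.GrenetZeon.HeavyTopLevelTwoChart

end
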